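import Literature.Probability.Percolation.TwoSetConditionalAssociation
import Literature.Probability.Percolation.KozmaNitzanGoodQuadruple
import Summits.CriticalPhenomena.PercolationContinuityZ3.Theorems.SoloBlindKNQuestion7
import HarnessLib

/-!
# Kozma–Nitzan's Question 9 is the master single-target candidate: Q9 ⇒ Q7 (the sure-hub construction)

Helper for crux `PercNearOneGluingNoHeavy.NoHeavyLowerTail` (item stmt-CriticalPhenomena-4575), lemma factory
prim-lf-2 (deletion–contraction), gen 6.

Kozma–Nitzan (arXiv:2401.12397, §5.5 p. 36) ask for which single relay `a ∈ A` the pre-FKG inequality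
(41) `P(0 ↔ b, 0 ↔ A) ≥ P(0 ↔ A, a ↔ b)` holds, and propose three candidates: Question 7 (`a` minimises
`P_G(a ↔ b)`), Question 8, and Question 9 (`a` minimises `P_H(a ↔ b)`, `H = G` minus the edges at `0`).  We record
the elementary but apparently unwritten fact that **Question 9 implies Question 7**: attach a NEW vertex `g` to `0`
by an edge of probability `1` (the tree's hub construction `TwoSetConditionalAssociation.hubConfig` with one block
`{0}` and an empty second block) and ask Question 9 at the observer `g` of the enlarged graph `G*`: deleting the edges
at `g` leaves `G` (plus the isolated `g`), so the Question-9 designation for `(G*, g)` is the Question-7 designation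
for `(G, 0)`, and since `g ≡ 0` almost surely, (41) at `g` in `G*` is (41) at `0` in `G`.  The same construction with
a hub glued surely to a SET `S` of vertices shows that Question 9 governs every "glued-source" form (in particular
the conclusion of Kozma–Nitzan's Conjecture 6, §5.3); the reachability lemmas below are stated for a general `S`.
Exact census of the designation family (prim-lf-2 CANDIDATES §GEN 6): 0 violations.

Contents: `KnQ9Hub.reachable_inl_iff` / `reachable_hub_iff` / `reachable_inter_wireSet_iff` (what the enlarged graph
connects, for a general glued set `S`), the transport of the three probabilities of Question 9 at the hub
(`KnQ9Hub.real_restrW_hub`, `real_hub_pre`, `real_hub_concl`), and the consequences of Question 9 (typed as an explicit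
hypothesis, in the `restrW` vocabulary of the tree, quantified over all finite vertex types):
* `SoloBlindKN.knQuestion7_of_question9` — **Q9 ⇒ Q7** (`KNQuestion7 w A o` for every finite weighted graph; `S = {o}`);
* (companion file `…KnQuestion9Shortening.lean`: **Q9 ⇒ Conjecture 6** in the registered `stub_shorteningStep` form with
  `S = {v, x}`, and the chain Q9 ⇒ Conjecture 2 (3) ⇒ the cruxes).
So among Kozma–Nitzan's three single-target candidates Question 9 is the strongest: it implies Question 7 and Conjecture 6.
No definitions, no sorries, standard axioms.
[cite: KozmaNitzan2024, Questions 7 and 9 (§5.5, p. 36); Conjecture 6 (§5.3, p. 34)]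
-/

noncomputable section

open MeasureTheory Set
open Literature.Probability.LatticeModels (prodBernoulli)
open Literature.Probability.Percolation
open Literature.Probability.Percolation.TwoSetConditionalAssociation

namespace Summit.CriticalPhenomena.PercolationContinuityZ3.Theorems

namespace KnQ9Hub

variable {V : Type*}

/-! ### Reachability in the one-block hub configuration `hubConfig (sides S ∅) ω` (hub `g = inr true` glued surely to `S`) -/

/-- The hub is joined to `inl v` iff some vertex of `S` is joined to `v`. [folklore] -/
theorem reachable_hub_iff (S : Set V) (ω : BondConfig V) (v : V) :
    (openGraph (hubConfig (sides S ∅) ω)).Reachable (Sum.inr true) (Sum.inl v) ↔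
      ∃ s ∈ S, (openGraph ω).Reachable s v := by
  refine ⟨fun h => exists_reachable_of_hub_reachable (sides S ∅) ω true (by simp [sides]) h, ?_⟩
  rintro ⟨s, hs, hsv⟩
  exact hubConfig_reachable_hub_inl (sides S ∅) ω (b := true) (by simpa [sides] using hs) hsv

/-- The set of vertices seen from `inl u`: old paths, or old paths into `S`, the hub, and out of `S`. [folklore] -/
theorem seen_closed (S : Set V) (ω : BondConfig V) (u : V) ⦃x y : V ⊕ Bool⦄
    (hx : x ∈ {x : V ⊕ Bool |
      (∃ z : V, x = Sum.inl z ∧ ((openGraph ω).Reachable u z ∨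
        ∃ s ∈ S, ∃ s' ∈ S, (openGraph ω).Reachable u s ∧ (openGraph ω).Reachable s' z)) ∨
      (x = Sum.inr true ∧ ∃ s ∈ S, (openGraph ω).Reachable u s)})
    (hxy : (openGraph (hubConfig (sides S ∅) ω)).Adj x y) :
    y ∈ {x : V ⊕ Bool |
      (∃ z : V, x = Sum.inl z ∧ ((openGraph ω).Reachable u z ∨
        ∃ s ∈ S, ∃ s' ∈ S, (openGraph ω).Reachable u s ∧ (openGraph ω).Reachable s' z)) ∨
      (x = Sum.inr true ∧ ∃ s ∈ S, (openGraph ω).Reachable u s)} := by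
  rw [openGraph_adj, mem_hubConfig_iff] at hxy
  obtain ⟨⟨e, he, hexy⟩ | ⟨b', t, ht, hexy⟩, hne⟩ := hxy
  · -- an old open edge `e = s(p, q)` with `{x, y} = {inl p, inl q}`
    have key : ∀ {p q : V}, s(p, q) ∈ ω → Sum.inl p = x → Sum.inl q = y →
        y ∈ {x : V ⊕ Bool |
          (∃ z : V, x = Sum.inl z ∧ ((openGraph ω).Reachable u z ∨
            ∃ s ∈ S, ∃ s' ∈ S, (openGraph ω).Reachable u s ∧ (openGraph ω).Reachable s' z)) ∨
          (x = Sum.inr true ∧ ∃ s ∈ S, (openGraph ω).Reachable u s)} := by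
      intro p q hpq hpx hqy
      subst hpx hqy
      have hadj : (openGraph ω).Adj p q := (openGraph_adj ω _ _).2 ⟨hpq, fun h => hne (by rw [h])⟩
      rcases hx with ⟨z, hz, hreach⟩ | ⟨hx, -⟩
      · cases hz
        refine Or.inl ⟨q, rfl, ?_⟩
        rcases hreach with h | ⟨s, hs, s', hs', hus, hs'z⟩
        · exact Or.inl (h.trans hadj.reachable)
        · exact Or.inr ⟨s, hs, s', hs', hus, hs'z.trans hadj.reachable⟩
      · exact absurd hx Sum.inl_ne_inr
    induction e using Sym2.ind with
    | h p q =>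
      rw [Sym2.map_mk, Sym2.eq_iff] at hexy
      rcases hexy with ⟨hpx, hqy⟩ | ⟨hpy, hqx⟩
      · exact key he hpx hqy
      · exact key (by rw [Sym2.eq_swap]; exact he) hqx hpy
  · -- a hub edge `s(inl t, inr b')` with `t ∈ sides S ∅ b'`, hence `b' = true` and `t ∈ S`
    have hb' : b' = true := by
      cases b'
      · simp [sides] at ht
      · rfl
    subst hb'
    have htS : t ∈ S := by simpa [sides] using ht
    rw [Sym2.eq_iff] at hexy
    rcases hexy with ⟨rfl, rfl⟩ | ⟨rfl, rfl⟩
    · -- x = inl t, y = inr true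
      rcases hx with ⟨z, hz, hreach⟩ | ⟨hx, -⟩
      · cases hz
        refine Or.inr ⟨rfl, ?_⟩
        rcases hreach with h | ⟨s, hs, s', hs', hus, -⟩
        · exact ⟨t, htS, h⟩
        · exact ⟨s, hs, hus⟩
      · exact absurd hx Sum.inl_ne_inr
    · -- x = inr true, y = inl t
      rcases hx with ⟨z, hz, -⟩ | ⟨-, s, hs, hus⟩
      · exact absurd hz Sum.inr_ne_inl
      · exact Or.inl ⟨t, rfl, Or.inr ⟨s, hs, t, htS, hus, SimpleGraph.Reachable.refl t⟩⟩

/-- **What the one-block hub graph connects**: `inl u ↔ inl v` iff `u ↔ v`, or `u` is joined to `S` and `S` to `v`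
(the hub glues `S`). [folklore] -/
theorem reachable_inl_iff (S : Set V) (ω : BondConfig V) (u v : V) :
    (openGraph (hubConfig (sides S ∅) ω)).Reachable (Sum.inl u) (Sum.inl v) ↔
      (openGraph ω).Reachable u v ∨
        ∃ s ∈ S, ∃ s' ∈ S, (openGraph ω).Reachable u s ∧ (openGraph ω).Reachable s' v := by
  constructor
  · intro h
    have hu : Sum.inl u ∈ {x : V ⊕ Bool |
        (∃ z : V, x = Sum.inl z ∧ ((openGraph ω).Reachable u z ∨
          ∃ s ∈ S, ∃ s' ∈ S, (openGraph ω).Reachable u s ∧ (openGraph ω).Reachable s' z)) ∨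
        (x = Sum.inr true ∧ ∃ s ∈ S, (openGraph ω).Reachable u s)} :=
      Or.inl ⟨u, rfl, Or.inl (SimpleGraph.Reachable.refl u)⟩
    rcases mem_of_reachable_of_closed (seen_closed S ω u) hu h with ⟨z, hz, hreach⟩ | ⟨hx, -⟩
    · cases hz
      exact hreach
    · exact absurd hx Sum.inl_ne_inr
  · rintro (h | ⟨s, hs, s', hs', hus, hs'v⟩)
    · exact hubConfig_reachable_inl _ h
    · exact ((hubConfig_reachable_inl (sides S ∅) hus).trans
        (hubConfig_adj_hub (sides S ∅) ω (b := true) (by simpa [sides] using hs)).reachable.symm).trans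
        (hubConfig_reachable_hub_inl (sides S ∅) ω (b := true) (by simpa [sides] using hs') hs'v)

/-- Old paths avoiding the hub: reachability between old vertices in the hub configuration cut down to the pairs off
the hub is old reachability. [folklore] -/
theorem reachable_inter_wireSet_iff (S : Set V) (ω : BondConfig V) (u v : V) :
    (openGraph (hubConfig (sides S ∅) ω ∩ wireSet ({Sum.inr true}ᶜ : Set (V ⊕ Bool)))).Reachable
        (Sum.inl u) (Sum.inl v) ↔ (openGraph ω).Reachable u v := by
  constructor
  · intro h
    -- the set `{inl z | u ↔ z}` is closed under adjacency off the hub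
    have hcl : ∀ ⦃x y : V ⊕ Bool⦄, x ∈ {x : V ⊕ Bool | ∃ z, x = Sum.inl z ∧ (openGraph ω).Reachable u z} →
        (openGraph (hubConfig (sides S ∅) ω ∩ wireSet ({Sum.inr true}ᶜ : Set (V ⊕ Bool)))).Adj x y →
        y ∈ {x : V ⊕ Bool | ∃ z, x = Sum.inl z ∧ (openGraph ω).Reachable u z} := by
      intro x y hx hxy
      obtain ⟨z, rfl, huz⟩ := hx
      rw [openGraph_adj, mem_inter_iff, mem_hubConfig_iff] at hxy
      obtain ⟨⟨⟨e, he, hexy⟩ | ⟨b', t, ht, hexy⟩, hwire⟩, hne⟩ := hxy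
      · induction e using Sym2.ind with
        | h p q =>
          have hadj : ∀ {p q : V}, s(p, q) ∈ ω → (Sum.inl p : V ⊕ Bool) = Sum.inl z → (Sum.inl q : V ⊕ Bool) = y →
              y ∈ {x : V ⊕ Bool | ∃ z, x = Sum.inl z ∧ (openGraph ω).Reachable u z} := by
            intro p q hpq hp hq
            cases Sum.inl_injective hp
            subst hq
            exact ⟨q, rfl, huz.trans ((openGraph_adj ω _ _).2 ⟨hpq, fun h => hne (by rw [h])⟩).reachable⟩
          rw [Sym2.map_mk, Sym2.eq_iff] at hexy
          rcases hexy with ⟨hp, hq⟩ | ⟨hp, hq⟩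
          · exact hadj he hp hq
          · exact hadj (by rw [Sym2.eq_swap]; exact he) hq hp
      · -- a hub edge contains the hub, so it is not off the hub
        exfalso
        have hb' : b' = true := by
          cases b'
          · simp [sides] at ht
          · rfl
        subst hb'
        rw [hexy, mk_mem_wireSet_iff] at hwire
        exact hwire.2.1 rfl
    obtain ⟨z, hz, huz⟩ := mem_of_reachable_of_closed hcl ⟨u, rfl, SimpleGraph.Reachable.refl u⟩ h
    cases Sum.inl_injective hz
    exact huz
  · intro h
    refine h.map { toFun := Sum.inl, map_rel' := fun {p q} hpq => ?_ }
    rw [openGraph_adj] at hpq ⊢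
    refine ⟨⟨?_, ?_⟩, fun h' => hpq.2 (Sum.inl_injective h')⟩
    · have h1 := (map_inl_mem_hubConfig_iff (sides S ∅) ω s(p, q)).2 hpq.1
      rwa [Sym2.map_mk] at h1
    · rw [mk_mem_wireSet_iff]
      exact ⟨Sum.inl_ne_inr, Sum.inl_ne_inr, fun h' => hpq.2 (Sum.inl_injective h')⟩

/-! ### The three probabilities of Question 9 in the hub graph, transported to the old graph -/

variable [Fintype V]

/-- The Question-9 reliability of an old vertex in the hub graph (hub deleted) is its reliability in the old graph:
`P_{G* ∖ g}(a ↔ b) = P_G(a ↔ b)`. [folklore] -/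
theorem real_restrW_hub (w : Sym2 V → unitInterval) (S : Set V) (a b : V) :
    (prodBernoulli (restrW ({Sum.inr true}ᶜ : Set (V ⊕ Bool)) (hubWeight w (sides S ∅)))).real
        (openConn (Sum.inl a) (Sum.inl b)) = (prodBernoulli w).real (openConn a b) := by
  rw [KNGoodAux.restrW_real_eq, measureReal_hub]
  congr 1
  ext ω
  simp only [mem_preimage, mem_setOf_eq, openConn]
  exact reachable_inter_wireSet_iff S ω a b

/-- `P_{G*}(a ↔ b, g ↔ A)` as an old probability. [folklore] -/
theorem real_hub_pre (w : Sym2 V → unitInterval) (S : Set V) (A : Finset V) (a b : V) :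
    (prodBernoulli (hubWeight w (sides S ∅))).real
        (openConn (Sum.inl a) (Sum.inl b) ∩ SoloBlindKN.connTo (Sum.inr true) (A.map Function.Embedding.inl)) =
      (prodBernoulli w).real {ω | ((openGraph ω).Reachable a b ∨
          ∃ s ∈ S, ∃ s' ∈ S, (openGraph ω).Reachable a s ∧ (openGraph ω).Reachable s' b) ∧
        ∃ a' ∈ A, ∃ s ∈ S, (openGraph ω).Reachable s a'} := by
  rw [measureReal_hub]
  congr 1
  ext ω
  simp only [SoloBlindKN.connTo, mem_preimage, mem_inter_iff, mem_iUnion, mem_setOf_eq, openConn,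
    Finset.mem_map, Function.Embedding.inl_apply, exists_prop]
  rw [reachable_inl_iff]
  refine and_congr Iff.rfl ⟨?_, ?_⟩
  · rintro ⟨x, ⟨a', ha', rfl⟩, hx⟩
    exact ⟨a', ha', (reachable_hub_iff S ω a').1 hx⟩
  · rintro ⟨a', ha', hx⟩
    exact ⟨Sum.inl a', ⟨a', ha', rfl⟩, (reachable_hub_iff S ω a').2 hx⟩

/-- `P_{G*}(g ↔ b, g ↔ A)` as an old probability. [folklore] -/
theorem real_hub_concl (w : Sym2 V → unitInterval) (S : Set V) (A : Finset V) (b : V) :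
    (prodBernoulli (hubWeight w (sides S ∅))).real
        (openConn (Sum.inr true) (Sum.inl b) ∩ SoloBlindKN.connTo (Sum.inr true) (A.map Function.Embedding.inl)) =
      (prodBernoulli w).real {ω | (∃ s ∈ S, (openGraph ω).Reachable s b) ∧
        ∃ a' ∈ A, ∃ s ∈ S, (openGraph ω).Reachable s a'} := by
  rw [measureReal_hub]
  congr 1
  ext ω
  simp only [SoloBlindKN.connTo, mem_preimage, mem_inter_iff, mem_iUnion, mem_setOf_eq, openConn,
    Finset.mem_map, Function.Embedding.inl_apply, exists_prop]
  rw [reachable_hub_iff]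
  refine and_congr Iff.rfl ⟨?_, ?_⟩
  · rintro ⟨x, ⟨a', ha', rfl⟩, hx⟩
    exact ⟨a', ha', (reachable_hub_iff S ω a').1 hx⟩
  · rintro ⟨a', ha', hx⟩
    exact ⟨Sum.inl a', ⟨a', ha', rfl⟩, (reachable_hub_iff S ω a').2 hx⟩

end KnQ9Hub

/-! ### Question 9 ⇒ Question 7 -/

namespace SoloBlindKN

open KnQ9Hub

variable {V : Type} [Fintype V] [DecidableEq V]

/-- **Kozma–Nitzan's Question 9 implies their Question 7** (both §5.5 p. 36 of arXiv:2401.12397).  The hypothesis is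
Question 9 for every finite weighted graph, in the tree's vocabulary: for an observer `o ∉ A` and a relay `a ∈ A`
minimising the reliability `P_{G∖o}(· ↔ b)` measured with the pairs at `o` closed (`restrW {o}ᶜ w`), the pre-FKG
inequality (41) `P(a ↔ b, o ↔ A) ≤ P(o ↔ b, o ↔ A)` holds.  The conclusion is `KNQuestion7 w A o` for every
`(G, A, o)`.  Proof: Question 9 at the hub `g` of the one-block hub graph over `S = {o}` (a new vertex glued to `o`
by a sure edge): its designation is the Question-7 designation of `(G, o)` (`KnQ9Hub.real_restrW_hub`) and its
two probabilities are those of (41) at `o` (`KnQ9Hub.real_hub_pre/concl` with `S = {o}`).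
[cite: KozmaNitzan2024, Questions 7 and 9 (§5.5, p. 36)] -/
theorem knQuestion7_of_question9
    (hQ9 : ∀ (W : Type) [Fintype W] [DecidableEq W] (w : Sym2 W → unitInterval) (A : Finset W) (o b a : W),
      o ∉ A → a ∈ A →
      (∀ a' ∈ A, (prodBernoulli (restrW ({o}ᶜ : Set W) w)).real (openConn a b) ≤
        (prodBernoulli (restrW ({o}ᶜ : Set W) w)).real (openConn a' b)) →
      (prodBernoulli w).real (openConn a b ∩ connTo o A) ≤ (prodBernoulli w).real (openConn o b ∩ connTo o A))
    (w : Sym2 V → unitInterval) (A : Finset V) (o : V) : KNQuestion7 w A o := by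
  intro b a ha hmin
  -- Question 9 at the hub of the one-block hub graph over `{o}`
  have hg : (Sum.inr true : V ⊕ Bool) ∉ A.map Function.Embedding.inl := by simp
  have ha' : (Sum.inl a : V ⊕ Bool) ∈ A.map Function.Embedding.inl := by simpa using ha
  have hmin' : ∀ a' ∈ A.map Function.Embedding.inl,
      (prodBernoulli (restrW ({Sum.inr true}ᶜ : Set (V ⊕ Bool)) (hubWeight w (sides ({o} : Set V) ∅)))).real
          (openConn (Sum.inl a) (Sum.inl b)) ≤
        (prodBernoulli (restrW ({Sum.inr true}ᶜ : Set (V ⊕ Bool)) (hubWeight w (sides ({o} : Set V) ∅)))).real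
          (openConn a' (Sum.inl b)) := by
    intro a' ha'
    obtain ⟨a'', ha'', rfl⟩ := Finset.mem_map.1 ha'
    rw [Function.Embedding.inl_apply, KnQ9Hub.real_restrW_hub, KnQ9Hub.real_restrW_hub]
    exact hmin a'' ha''
  have key := hQ9 (V ⊕ Bool) (hubWeight w (sides ({o} : Set V) ∅)) (A.map Function.Embedding.inl)
    (Sum.inr true) (Sum.inl b) (Sum.inl a) hg ha' hmin'
  rw [KnQ9Hub.real_hub_pre, KnQ9Hub.real_hub_concl] at key
  -- with `S = {o}` the two events are `{a ↔ b} ∩ {o ↔ A}` and `{o ↔ b} ∩ {o ↔ A}`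
  have h1 : {ω : BondConfig V | ((openGraph ω).Reachable a b ∨
        ∃ s ∈ ({o} : Set V), ∃ s' ∈ ({o} : Set V), (openGraph ω).Reachable a s ∧ (openGraph ω).Reachable s' b) ∧
        ∃ a' ∈ A, ∃ s ∈ ({o} : Set V), (openGraph ω).Reachable s a'} = openConn a b ∩ connTo o A := by
    ext ω
    simp only [mem_singleton_iff, exists_eq_left, mem_setOf_eq, connTo, mem_inter_iff, mem_iUnion, exists_prop,
      openConn]
    constructor
    · rintro ⟨h | ⟨hao, hob⟩, a', ha', hoa'⟩
      · exact ⟨h, a', ha', hoa'⟩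
      · exact ⟨hao.trans hob, a', ha', hoa'⟩
    · rintro ⟨h, a', ha', hoa'⟩
      exact ⟨Or.inl h, a', ha', hoa'⟩
  have h2 : {ω : BondConfig V | (∃ s ∈ ({o} : Set V), (openGraph ω).Reachable s b) ∧
        ∃ a' ∈ A, ∃ s ∈ ({o} : Set V), (openGraph ω).Reachable s a'} = openConn o b ∩ connTo o A := by
    ext ω
    simp only [mem_singleton_iff, exists_eq_left, mem_setOf_eq, connTo, mem_inter_iff, mem_iUnion, exists_prop,
      openConn]
  rw [h1, h2] at key
  exact key

end SoloBlindKN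

end Summit.CriticalPhenomena.PercolationContinuityZ3.Theorems
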